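import Summits.MatrixMultiplication.MatrixMultiplication.Theorems.SoloBlindHypergraphDegTwo
import Summits.MatrixMultiplication.MatrixMultiplication.Theorems.SoloBlindHypergraphCone

/-!
# The hypergraph Kraft conjecture for at most four vertices; Conjecture E and (K₃) at targets with ≤ 4 representations

Sub-programme (K₃), finite form (♣).  By the degree-2 reduction (`SoloBlindHypergraphDegTwo`): at a vertex `v` of
degree `2` every other vertex loses exactly one edge when `v` and its two edges are deleted
(`soloBlind_degTwo_deg`), so `K(P) = 1/4 + K(P ∖ v)/2` and the three-vertex theorem applies to `P ∖ v`; if no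
vertex has degree `2`, all degrees are `≥ 3` and `K ≤ 4/8`.  Hence `soloBlind_hgKraft_le_of_card_le_four`, and —
through the atom hypergraph and the cone — CONJECTURE E at every H-good target with at most four representations
(`soloBlind_conjE_of_card_repAll_le_four`) and (K₃) at every target with at most four representations
(`soloBlind_kraft_of_card_repAll_le_four`), unconditionally, in every rank.
-/

namespace Summit.MatrixMultiplication.MatrixMultiplication.Theorems

open Finset

universe u v

section Hypergraph

variable {W : Type*} [DecidableEq W]

/-- Degree bookkeeping at a degree-`2` vertex `v`: every other vertex loses exactly one edge in `P ∖ v`. -/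
theorem soloBlind_degTwo_deg {F : Finset W} {P : Finset (Finset W)} (hadm : soloBlindHgAdmissible F P)
    {v : W} (hv : v ∈ F) (hdeg : soloBlindHgDeg P v = 2) {u : W} (hu : u ∈ F) (huv : u ≠ v) :
    soloBlindHgDeg P u = soloBlindHgDeg (P.filter (fun J => v ∉ J)) u + 1 := by
  obtain ⟨A, hA, B, hB, _, hvA, hvB, honly, hpart⟩ := soloBlind_hg_degTwo_structure hadm hv hdeg
  unfold soloBlindHgDeg
  have hsplit := Finset.card_filter_add_card_filter_not
    (s := P.filter (fun J => u ∈ J)) (fun J => v ∉ J)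
  have h1 : (P.filter (fun J => u ∈ J)).filter (fun J => v ∉ J) =
      (P.filter (fun J => v ∉ J)).filter (fun J => u ∈ J) := by
    ext J
    simp only [Finset.mem_filter]
    tauto
  have huB : u ∉ A → u ∈ B := fun h => by by_contra h'; exact h ((hpart u hu huv).mpr h')
  have h2 : (P.filter (fun J => u ∈ J)).filter (fun J => ¬ (v ∉ J)) =
      {if u ∈ A then A else B} := by
    ext J
    simp only [Finset.mem_filter, Finset.mem_singleton, not_not]
    constructor
    · rintro ⟨⟨hJ, huJ⟩, hvJ⟩
      rcases honly J hJ hvJ with rfl | rfl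
      · rw [if_pos huJ]
      · have huA : u ∉ A := fun h => ((hpart u hu huv).mp h) huJ
        rw [if_neg huA]
    · rintro rfl
      by_cases huA : u ∈ A
      · rw [if_pos huA]; exact ⟨⟨hA, huA⟩, hvA⟩
      · rw [if_neg huA]; exact ⟨⟨hB, huB huA⟩, hvB⟩
  rw [h1, h2, Finset.card_singleton] at hsplit
  omega

/-- THE HYPERGRAPH KRAFT CONJECTURE FOR AT MOST FOUR VERTICES. -/
theorem soloBlind_hgKraft_le_of_card_le_four (F : Finset W) (P : Finset (Finset W))
    (hPF : ∀ J ∈ P, J ⊆ F) (hadm : soloBlindHgAdmissible F P) (hcard : F.card ≤ 4) :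
    soloBlindHgKraft F P ≤ 1 / 2 := by
  by_cases h3 : F.card ≤ 3
  · exact soloBlind_hgKraft_le_of_card_le_three F P hPF hadm h3
  have h4 : F.card = 4 := by omega
  by_cases hex : ∃ v ∈ F, soloBlindHgDeg P v = 2
  · -- reduce at a degree-2 vertex
    obtain ⟨v, hv, hdeg⟩ := hex
    have hadm' := soloBlind_hg_degTwo_admissible hPF hadm hv hdeg
    have hPF' : ∀ J ∈ P.filter (fun J => v ∉ J), J ⊆ F.erase v := by
      intro J hJ
      obtain ⟨hJP, hvJ⟩ := Finset.mem_filter.mp hJ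
      intro x hx
      exact Finset.mem_erase.mpr ⟨fun h => hvJ (h ▸ hx), hPF J hJP hx⟩
    have hK' : soloBlindHgKraft (F.erase v) (P.filter (fun J => v ∉ J)) ≤ 1 / 2 :=
      soloBlind_hgKraft_le_of_card_le_three _ _ hPF' hadm'
        (by rw [Finset.card_erase_of_mem hv]; omega)
    have hKey : soloBlindHgKraft F P =
        1 / 4 + soloBlindHgKraft (F.erase v) (P.filter (fun J => v ∉ J)) / 2 := by
      unfold soloBlindHgKraft
      rw [← Finset.add_sum_erase F _ hv, hdeg]
      have hs : ∑ u ∈ F.erase v, (1 / 2 : ℚ) ^ soloBlindHgDeg P u =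
          ∑ u ∈ F.erase v, (1 / 2 : ℚ) ^ soloBlindHgDeg (P.filter (fun J => v ∉ J)) u / 2 := by
        refine Finset.sum_congr rfl (fun u hu => ?_)
        obtain ⟨huv, huF⟩ := Finset.mem_erase.mp hu
        rw [soloBlind_degTwo_deg hadm hv hdeg huF huv, pow_succ]
        ring
      rw [hs, ← Finset.sum_div]
      norm_num
    rw [hKey]
    linarith
  · -- no degree-2 vertex: all degrees are at least 3
    push Not at hex
    have hdeg3 : ∀ u ∈ F, 3 ≤ soloBlindHgDeg P u := by
      intro u hu
      obtain ⟨w, hw, hwu⟩ : ∃ w ∈ F, w ≠ u := by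
        by_contra hno
        push Not at hno
        have hsub : F ⊆ {u} := fun w hw => Finset.mem_singleton.mpr (hno w hw)
        have := Finset.card_le_card hsub
        rw [Finset.card_singleton] at this
        omega
      have h2 := soloBlind_hg_two_le_deg hadm hu hw hwu.symm
      have hne := hex u hu
      omega
    unfold soloBlindHgKraft
    calc ∑ u ∈ F, (1 / 2 : ℚ) ^ soloBlindHgDeg P u ≤ ∑ u ∈ F, (1 / 8 : ℚ) := by
          apply Finset.sum_le_sum
          intro u hu
          calc (1 / 2 : ℚ) ^ soloBlindHgDeg P u ≤ (1 / 2) ^ 3 :=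
                pow_le_pow_of_le_one (by norm_num) (by norm_num) (hdeg3 u hu)
            _ = 1 / 8 := by norm_num
      _ = 1 / 2 := by rw [Finset.sum_const, h4]; norm_num

end Hypergraph

variable {ι : Type v} [DecidableEq ι]
variable {G : Type u} [AddCommGroup G] [DecidableEq G]

/-- CONJECTURE E AT TARGETS WITH AT MOST FOUR REPRESENTATIONS (every rank, exponent `3`, zero-sum-free `h`,
H-good `σ`): unconditional. -/
theorem soloBlind_conjE_of_card_repAll_le_four (three : ∀ g : G, g + g + g = 0) (h : ι → G) (S : Finset ι)
    (σ : G) (zsf : ∀ T ⊆ S, T.Nonempty → ∑ i ∈ T, h i ≠ 0) (hgood : ∀ T ⊆ S, ∑ i ∈ T, h i ≠ σ + σ)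
    (hN : (soloBlindSeqRepAll h S σ).card ≤ 4) : soloBlindMass h S σ ≤ 1 / 2 :=
  (soloBlind_mass_le_hgKraft h S σ).trans
    (soloBlind_hgKraft_le_of_card_le_four _ _ (soloBlind_atomHg_edge_subset h S σ)
      (soloBlind_atomHg_admissible three zsf hgood) hN)

/-- (K₃) AT TARGETS WITH AT MOST FOUR REPRESENTATIONS (every rank): through the cone. -/
theorem soloBlind_kraft_of_card_repAll_le_four (three : ∀ g : G, g + g + g = 0) (h : ι → G) (S : Finset ι)
    (zsf : ∀ T ⊆ S, T.Nonempty → ∑ i ∈ T, h i ≠ 0) (σ : G) (hN : (soloBlindSeqRepAll h S σ).card ≤ 4) :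
    soloBlindMass h S σ ≤ 1 := by
  have hcone := soloBlind_conjE_of_card_repAll_le_four (soloBlind_cone_three three) (soloBlindCone h)
    (insertNone S) ((σ, 1) : G × ZMod 3) (soloBlind_cone_zsf zsf) (soloBlind_cone_hgood h S σ)
    (by rw [soloBlind_cone_repAll_card]; exact hN)
  rw [soloBlind_cone_mass] at hcone
  linarith

end Summit.MatrixMultiplication.MatrixMultiplication.Theorems
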